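import Literature.Analysis.FluidPDE.BoltzmannEquation
import Summits.AtomisticToContinuum.HydrodynamicLimit.Theorems.JParityClosureParityRigidityInvariance

/-!
# Gaussian mollification of `m ⊗ m` on the Euclidean product (helper for `ParityRigidity`)

Bookkeeping for the rigidity theorem `ParityRigidity` (item stmt-AtomisticToContinuum-13084):

* an elementary real lemma on `Φ(y) = y (1 - e^{-y})` and the *pointwise rigidity lemma*
  `eq_one_of_liminf_eq_zero`: if `r_n → R < ∞` with `0 < r_n < ∞` and
  `liminf B Φ(-log r_n) = 0` for some `B > 0`, then `R = 1`;
* the collision map is a linear isometric involution of `WithLp 2 (E × E)`, whence Gaussian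
  mollification commutes with it (`lintegral_exp_collideLp`);
* the mollified pair density `h_ϑ(v) h_ϑ(w)`, `h_ϑ = m ∗ G_{ϑ²}`, is `C_ϑ²` times the Gaussian
  average of `ν = (m ⊗ m) ∘ toLp⁻¹` (`hprod_eq`), so that the surprisal jump
  `F_ϑ = log h h_* - log h' h'_*` is minus the logarithm of a ratio of Gaussian averages of
  `T̂_# ν` and `ν` (`surprisal_eq`).

Helper file for item stmt-AtomisticToContinuum-13084 (route JParityClosure, decl `ParityRigidity`).
-/

open MeasureTheory Metric Real Filter Topology Set Complex
open scoped InnerProductSpace ENNReal NNReal Topology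

namespace Summit.AtomisticToContinuum.HydrodynamicLimit.Theorems.ParityRigidity

open Literature.MathematicalPhysics.KineticTheory Literature.Analysis.FluidPDE

/-! ### An elementary real lemma: `Φ(y) = y (1 - e^{-y})` -/

/-- `y (1 - e^{-y}) > 0` for `y ≠ 0`. -/
theorem mul_one_sub_exp_neg_pos {y : ℝ} (hy : y ≠ 0) :
    0 < y * (1 - Real.exp (-y)) := by
  rcases lt_or_gt_of_ne hy with h | h
  · have : 1 - Real.exp (-y) < 0 := by
      have : 1 < Real.exp (-y) := Real.one_lt_exp_iff.2 (by linarith)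
      linarith
    exact mul_pos_of_neg_of_neg h this
  · have : 0 < 1 - Real.exp (-y) := by
      have : Real.exp (-y) < 1 := Real.exp_lt_one_iff.2 (by linarith)
      linarith
    exact mul_pos h this

/-- `y (1 - e^{-y}) ≥ y - 1`. -/
theorem sub_one_le_mul_one_sub_exp_neg (y : ℝ) :
    y - 1 ≤ y * (1 - Real.exp (-y)) := by
  have h1 : y * Real.exp (-y) ≤ 1 := by
    have h2 : y ≤ Real.exp y := by linarith [Real.add_one_le_exp y]
    have h3 : 0 < Real.exp (-y) := Real.exp_pos _
    calc y * Real.exp (-y) ≤ Real.exp y * Real.exp (-y) := by gcongr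
      _ = 1 := by rw [← Real.exp_add, add_neg_cancel, Real.exp_zero]
  nlinarith

/-- **Pointwise rigidity lemma.** Let `r_n → R < ∞` in `ℝ≥0∞` with `0 < r_n < ∞`, `B > 0`, and
suppose `liminf_n B Φ(-log r_n) = 0` where `Φ(y) = y (1 - e^{-y})`.  Then `R = 1`. -/
theorem eq_one_of_liminf_eq_zero {R : ℝ≥0∞} (hR : R ≠ ⊤) {r : ℕ → ℝ≥0∞}
    (hr : Tendsto r atTop (𝓝 R)) (hr0 : ∀ n, r n ≠ 0) (hrt : ∀ n, r n ≠ ⊤) {B : ℝ} (hB : 0 < B)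
    (h : liminf (fun n => ENNReal.ofReal (B * (-Real.log (r n).toReal *
      (1 - Real.exp (-(-Real.log (r n).toReal)))))) atTop = 0) : R = 1 := by
  have hrpos : ∀ n, 0 < (r n).toReal := fun n => ENNReal.toReal_pos (hr0 n) (hrt n)
  have hreal : Tendsto (fun n => (r n).toReal) atTop (𝓝 R.toReal) :=
    (ENNReal.tendsto_toReal hR).comp hr
  by_cases hR0 : R = 0
  · exfalso
    -- `-log r_n → +∞`, hence the integrand tends to `⊤`
    have h0 : Tendsto (fun n => (r n).toReal) atTop (𝓝[>] 0) := by
      rw [hR0, ENNReal.toReal_zero] at hreal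
      exact tendsto_nhdsWithin_iff.2 ⟨hreal, Eventually.of_forall hrpos⟩
    have hlog : Tendsto (fun n => -Real.log (r n).toReal) atTop atTop :=
      tendsto_neg_atBot_atTop.comp (Real.tendsto_log_nhdsGT_zero.comp h0)
    have hΦ : Tendsto (fun n => -Real.log (r n).toReal *
        (1 - Real.exp (-(-Real.log (r n).toReal)))) atTop atTop := by
      refine tendsto_atTop_mono (fun n => sub_one_le_mul_one_sub_exp_neg _) ?_
      exact tendsto_atTop_add_const_right _ _ hlog
    have hBΦ : Tendsto (fun n => ENNReal.ofReal (B * (-Real.log (r n).toReal *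
        (1 - Real.exp (-(-Real.log (r n).toReal)))))) atTop (𝓝 ⊤) :=
      ENNReal.tendsto_ofReal_atTop.comp (hΦ.const_mul_atTop hB)
    rw [hBΦ.liminf_eq] at h
    exact ENNReal.top_ne_zero h
  · have hRpos : 0 < R.toReal := ENNReal.toReal_pos hR0 hR
    set y₀ : ℝ := -Real.log R.toReal with hy₀
    have hy : Tendsto (fun n => -Real.log (r n).toReal) atTop (𝓝 y₀) :=
      ((Real.continuousAt_log hRpos.ne').tendsto.comp hreal).neg
    have hΦ : Tendsto (fun n => -Real.log (r n).toReal *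
        (1 - Real.exp (-(-Real.log (r n).toReal)))) atTop (𝓝 (y₀ * (1 - Real.exp (-y₀)))) :=
      hy.mul (tendsto_const_nhds.sub (Real.continuous_exp.continuousAt.tendsto.comp hy.neg))
    have hBΦ : Tendsto (fun n => ENNReal.ofReal (B * (-Real.log (r n).toReal *
        (1 - Real.exp (-(-Real.log (r n).toReal)))))) atTop
        (𝓝 (ENNReal.ofReal (B * (y₀ * (1 - Real.exp (-y₀)))))) :=
      (ENNReal.continuous_ofReal.tendsto _).comp (hΦ.const_mul B)
    rw [hBΦ.liminf_eq, ENNReal.ofReal_eq_zero] at h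
    have hΦ0 : y₀ * (1 - Real.exp (-y₀)) ≤ 0 := by
      by_contra hcon
      exact absurd h (not_le.2 (mul_pos hB (not_le.1 hcon)))
    have hy0 : y₀ = 0 := by
      by_contra hne
      exact absurd hΦ0 (not_le.2 (mul_one_sub_exp_neg_pos hne))
    have hlog0 : Real.log R.toReal = 0 := by rw [hy₀] at hy0; linarith
    rcases Real.log_eq_zero.1 hlog0 with h0 | h1 | h2
    · exact absurd h0 hRpos.ne'
    · exact (ENNReal.toReal_eq_one_iff R).1 h1
    · linarith

/-! ### Gaussian mollification algebra on the Euclidean product -/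

section Algebra

variable {E : Type*} [NormedAddCommGroup E] [InnerProductSpace ℝ E]

/-- The collision map is linear: it commutes with subtraction. -/
theorem collide_sub (ω : sphere (0 : E) 1) (p q : E × E) :
    collide ω (p - q) = collide ω p - collide ω q := by
  obtain ⟨a, b⟩ := p
  obtain ⟨c, d⟩ := q
  simp only [collide, Prod.mk_sub_mk, Prod.mk.injEq]
  have h : ⟪a - c - (b - d), (ω : E)⟫_ℝ = ⟪a - b, (ω : E)⟫_ℝ - ⟪c - d, (ω : E)⟫_ℝ := by
    rw [← inner_sub_left]; congr 1; abel
  rw [h, sub_smul]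
  constructor <;> abel

/-- The collision map is an isometry of the Euclidean product `WithLp 2 (E × E)`. -/
theorem norm_toLp_collide (ω : sphere (0 : E) 1) (p : E × E) :
    ‖WithLp.toLp 2 (collide ω p)‖ = ‖WithLp.toLp 2 p‖ := by
  have h := norm_sq_collide_fst_add_norm_sq_collide_snd ω p
  have h1 : ‖WithLp.toLp 2 (collide ω p)‖ ^ 2 = ‖WithLp.toLp 2 p‖ ^ 2 := by
    rw [WithLp.prod_norm_sq_eq_of_L2, WithLp.prod_norm_sq_eq_of_L2]
    exact h
  exact (sq_eq_sq₀ (norm_nonneg _) (norm_nonneg _)).1 h1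

/-- Self-adjointness of the transported collision map `T̂`: `‖T̂ a - b‖ = ‖a - T̂ b‖`. -/
theorem norm_collideLp_sub (ω : sphere (0 : E) 1) (a b : WithLp 2 (E × E)) :
    ‖WithLp.toLp 2 (collide ω (WithLp.ofLp a)) - b‖ =
      ‖a - WithLp.toLp 2 (collide ω (WithLp.ofLp b))‖ := by
  have hb : b = WithLp.toLp 2 (collide ω (collide ω (WithLp.ofLp b))) := by
    rw [collide_collide, WithLp.toLp_ofLp]
  conv_lhs => rw [hb]
  rw [← WithLp.toLp_sub, ← collide_sub, norm_toLp_collide,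
    WithLp.toLp_sub, WithLp.toLp_ofLp]

end Algebra

section Mollify

variable {E : Type*} [NormedAddCommGroup E] [InnerProductSpace ℝ E] [FiniteDimensional ℝ E]
  [MeasurableSpace E] [BorelSpace E]

/-- Gaussian mollification commutes with the isometry `T̂`: the Gaussian average of `ν` at `T̂ x`
is the Gaussian average of `T̂_# ν` at `x`. -/
theorem lintegral_exp_collideLp (ω : sphere (0 : E) 1)
    (ν : Measure (WithLp 2 (E × E))) (s : ℝ) (x : WithLp 2 (E × E)) :
    ∫⁻ z, ENNReal.ofReal (Real.exp (-‖WithLp.toLp 2 (collide ω (WithLp.ofLp x)) - z‖ ^ 2 / s)) ∂ν =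
      ∫⁻ z, ENNReal.ofReal (Real.exp (-‖x - z‖ ^ 2 / s))
        ∂(ν.map fun y : WithLp 2 (E × E) => WithLp.toLp 2 (collide ω (WithLp.ofLp y))) := by
  have hT : Measurable fun y : WithLp 2 (E × E) => WithLp.toLp 2 (collide ω (WithLp.ofLp y)) :=
    (WithLp.measurable_toLp 2 _).comp
      ((continuous_collide ω).measurable.comp (WithLp.measurable_ofLp 2 _))
  have hf : Measurable fun z : WithLp 2 (E × E) => ENNReal.ofReal (Real.exp (-‖x - z‖ ^ 2 / s)) :=
    (Continuous.measurable (by fun_prop)).ennreal_ofReal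
  rw [lintegral_map hf hT]
  refine lintegral_congr fun z => ?_
  rw [norm_collideLp_sub]

variable (m : Measure E) [IsProbabilityMeasure m]

omit [FiniteDimensional ℝ E] [BorelSpace E] [IsProbabilityMeasure m] in
/-- The Gaussian mollification `h_ϑ = m ∗ G_{ϑ²}` as a multiple of an unnormalised Gaussian
average. -/
theorem integral_localMaxwellian_eq (ϑ : ℝ) (v : E) :
    ∫ v', localMaxwellian 1 (ϑ ^ 2) v v' ∂m =
      (2 * π * ϑ ^ 2) ^ (-(Module.finrank ℝ E : ℝ) / 2) *
        ∫ v', Real.exp (-‖v - v'‖ ^ 2 / (2 * ϑ ^ 2)) ∂m := by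
  simp only [localMaxwellian, one_mul, norm_sub_rev _ v]
  exact integral_const_mul _ _

omit [InnerProductSpace ℝ E] [FiniteDimensional ℝ E] in
/-- The unnormalised Gaussian average of a probability measure is positive. -/
theorem integral_exp_neg_norm_sq_pos {s : ℝ} (hs : 0 ≤ s) (v : E) :
    0 < ∫ v', Real.exp (-‖v - v'‖ ^ 2 / s) ∂m := by
  refine integral_exp_pos ?_
  refine (integrable_const (1 : ℝ)).mono' (Continuous.aestronglyMeasurable (by fun_prop))
    (Eventually.of_forall fun v' => ?_)
  rw [Real.norm_eq_abs, abs_of_pos (Real.exp_pos _), ← Real.exp_zero]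
  refine Real.exp_le_exp.2 ?_
  rw [neg_div, neg_nonpos]
  exact div_nonneg (sq_nonneg _) hs

omit [FiniteDimensional ℝ E] in
/-- The Gaussian mollification `h_ϑ` is positive for `ϑ ≠ 0`. -/
theorem integral_localMaxwellian_pos {ϑ : ℝ} (hϑ : ϑ ≠ 0) (v : E) :
    0 < ∫ v', localMaxwellian 1 (ϑ ^ 2) v v' ∂m := by
  rw [integral_localMaxwellian_eq]
  refine mul_pos (Real.rpow_pos_of_pos (by positivity) _) ?_
  exact integral_exp_neg_norm_sq_pos m (by positivity) v

/-- The Gaussian mollification `h_ϑ` is measurable. -/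
theorem measurable_integral_localMaxwellian (ϑ : ℝ) :
    Measurable fun v : E => ∫ v', localMaxwellian 1 (ϑ ^ 2) v v' ∂m := by
  have hc : Continuous fun q : E × E => localMaxwellian 1 (ϑ ^ 2) q.1 q.2 := by
    unfold localMaxwellian
    fun_prop
  exact (hc.stronglyMeasurable.integral_prod_right' (ν := m)).measurable

/-- **Product formula.** `(∫ G dm)(v) (∫ G dm)(w)` is the Gaussian average of
`ν = (m ⊗ m) ∘ toLp⁻¹` on the Euclidean product at `(v, w)`. -/
theorem integral_exp_mul_integral_exp {s : ℝ} (v w : E) :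
    (∫ v', Real.exp (-‖v - v'‖ ^ 2 / s) ∂m) * (∫ w', Real.exp (-‖w - w'‖ ^ 2 / s) ∂m) =
      (∫⁻ z, ENNReal.ofReal (Real.exp (-‖WithLp.toLp 2 (v, w) - z‖ ^ 2 / s))
        ∂((m.prod m).map (WithLp.toLp 2) : Measure (WithLp 2 (E × E)))).toReal := by
  rw [← integral_prod_mul]
  have hmeas : AEMeasurable (WithLp.toLp 2 : E × E → WithLp 2 (E × E)) (m.prod m) :=
    (WithLp.measurable_toLp 2 _).aemeasurable
  have hcont : Continuous fun z : WithLp 2 (E × E) =>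
      Real.exp (-‖WithLp.toLp 2 (v, w) - z‖ ^ 2 / s) := by fun_prop
  have h1 : ∫ z, Real.exp (-‖WithLp.toLp 2 (v, w) - z‖ ^ 2 / s)
      ∂((m.prod m).map (WithLp.toLp 2) : Measure (WithLp 2 (E × E))) =
      ∫ p, Real.exp (-‖WithLp.toLp 2 (v, w) - WithLp.toLp 2 p‖ ^ 2 / s) ∂(m.prod m) :=
    integral_map hmeas hcont.aestronglyMeasurable
  have h2 : ∀ p : E × E, Real.exp (-‖v - p.1‖ ^ 2 / s) * Real.exp (-‖w - p.2‖ ^ 2 / s) =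
      Real.exp (-‖WithLp.toLp 2 (v, w) - WithLp.toLp 2 p‖ ^ 2 / s) := by
    intro p
    rw [← Real.exp_add, ← WithLp.toLp_sub, WithLp.prod_norm_sq_eq_of_L2]
    congr 1
    simp only [WithLp.toLp_fst, WithLp.toLp_snd, Prod.fst_sub, Prod.snd_sub]
    ring
  rw [integral_eq_lintegral_of_nonneg_ae (Eventually.of_forall fun z => (Real.exp_pos _).le)
    hcont.aestronglyMeasurable] at h1
  exact (integral_congr_ae (Eventually.of_forall h2)).trans h1.symm

/-- **The mollified pair density** `h_ϑ(v) h_ϑ(w) = C_ϑ² · (ν ∗ G_{2ϑ²})(v, w)`. -/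
theorem hprod_eq (ϑ : ℝ) (p : E × E) :
    (∫ v', localMaxwellian 1 (ϑ ^ 2) p.1 v' ∂m) * (∫ v', localMaxwellian 1 (ϑ ^ 2) p.2 v' ∂m) =
      ((2 * π * ϑ ^ 2) ^ (-(Module.finrank ℝ E : ℝ) / 2)) ^ 2 *
        (∫⁻ z, ENNReal.ofReal (Real.exp (-‖WithLp.toLp 2 p - z‖ ^ 2 / (2 * ϑ ^ 2)))
          ∂((m.prod m).map (WithLp.toLp 2) : Measure (WithLp 2 (E × E)))).toReal := by
  rw [integral_localMaxwellian_eq, integral_localMaxwellian_eq,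
    ← integral_exp_mul_integral_exp m p.1 p.2]
  ring

/-- **The surprisal jump as a log-ratio of Gaussian averages.** For `ϑ ≠ 0`,
`F_ϑ(ω, p) = -log ((T̂_# ν ∗ G)(p̂) / (ν ∗ G)(p̂))`, and the ratio is positive and finite. -/
theorem surprisal_eq {ϑ : ℝ} (hϑ : ϑ ≠ 0) (ω : sphere (0 : E) 1) (p : E × E)
    (ν : Measure (WithLp 2 (E × E))) (T : WithLp 2 (E × E) → WithLp 2 (E × E))
    (hν : ν = (m.prod m).map (WithLp.toLp 2))
    (hT : T = fun y : WithLp 2 (E × E) => WithLp.toLp 2 (collide ω (WithLp.ofLp y))) :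
    (∫⁻ z, ENNReal.ofReal (Real.exp (-‖WithLp.toLp 2 p - z‖ ^ 2 / (2 * ϑ ^ 2))) ∂(ν.map T)) /
        (∫⁻ z, ENNReal.ofReal (Real.exp (-‖WithLp.toLp 2 p - z‖ ^ 2 / (2 * ϑ ^ 2))) ∂ν) ≠ 0 ∧
    (∫⁻ z, ENNReal.ofReal (Real.exp (-‖WithLp.toLp 2 p - z‖ ^ 2 / (2 * ϑ ^ 2))) ∂(ν.map T)) /
        (∫⁻ z, ENNReal.ofReal (Real.exp (-‖WithLp.toLp 2 p - z‖ ^ 2 / (2 * ϑ ^ 2))) ∂ν) ≠ ⊤ ∧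
    Real.log (∫ v', localMaxwellian 1 (ϑ ^ 2) p.1 v' ∂m) +
      Real.log (∫ v', localMaxwellian 1 (ϑ ^ 2) p.2 v' ∂m) -
      Real.log (∫ v', localMaxwellian 1 (ϑ ^ 2) (collide ω p).1 v' ∂m) -
      Real.log (∫ v', localMaxwellian 1 (ϑ ^ 2) (collide ω p).2 v' ∂m) =
      -Real.log ((∫⁻ z, ENNReal.ofReal (Real.exp (-‖WithLp.toLp 2 p - z‖ ^ 2 / (2 * ϑ ^ 2)))
          ∂(ν.map T)) /
        (∫⁻ z, ENNReal.ofReal (Real.exp (-‖WithLp.toLp 2 p - z‖ ^ 2 / (2 * ϑ ^ 2))) ∂ν)).toReal := by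
  subst hν hT
  have hCpos : 0 < ((2 * π * ϑ ^ 2) ^ (-(Module.finrank ℝ E : ℝ) / 2)) ^ 2 :=
    pow_pos (Real.rpow_pos_of_pos (by positivity) _) 2
  have h1 := hprod_eq m ϑ p
  have h2 := hprod_eq m ϑ (collide ω p)
  have h2' : (∫⁻ z, ENNReal.ofReal (Real.exp (-‖WithLp.toLp 2 (collide ω p) - z‖ ^ 2 / (2 * ϑ ^ 2)))
      ∂((m.prod m).map (WithLp.toLp 2) : Measure (WithLp 2 (E × E)))) =
      ∫⁻ z, ENNReal.ofReal (Real.exp (-‖WithLp.toLp 2 p - z‖ ^ 2 / (2 * ϑ ^ 2)))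
        ∂(((m.prod m).map (WithLp.toLp 2) : Measure (WithLp 2 (E × E))).map
          fun y : WithLp 2 (E × E) => WithLp.toLp 2 (collide ω (WithLp.ofLp y))) := by
    have h := lintegral_exp_collideLp ω
      ((m.prod m).map (WithLp.toLp 2) : Measure (WithLp 2 (E × E))) (2 * ϑ ^ 2) (WithLp.toLp 2 p)
    rwa [WithLp.ofLp_toLp] at h
  rw [h2'] at h2
  set C : ℝ := ((2 * π * ϑ ^ 2) ^ (-(Module.finrank ℝ E : ℝ) / 2)) ^ 2 with hC
  set N₁ : ℝ≥0∞ := ∫⁻ z, ENNReal.ofReal (Real.exp (-‖WithLp.toLp 2 p - z‖ ^ 2 / (2 * ϑ ^ 2)))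
    ∂((m.prod m).map (WithLp.toLp 2) : Measure (WithLp 2 (E × E))) with hN₁
  set N₂ : ℝ≥0∞ := ∫⁻ z, ENNReal.ofReal (Real.exp (-‖WithLp.toLp 2 p - z‖ ^ 2 / (2 * ϑ ^ 2)))
    ∂(((m.prod m).map (WithLp.toLp 2) : Measure (WithLp 2 (E × E))).map
      fun y : WithLp 2 (E × E) => WithLp.toLp 2 (collide ω (WithLp.ofLp y))) with hN₂
  have hp1 := integral_localMaxwellian_pos m hϑ p.1
  have hp2 := integral_localMaxwellian_pos m hϑ p.2
  have hp3 := integral_localMaxwellian_pos m hϑ (collide ω p).1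
  have hp4 := integral_localMaxwellian_pos m hϑ (collide ω p).2
  have hN₁pos : 0 < N₁.toReal := by
    have h : 0 < C * N₁.toReal := by rw [← h1]; exact mul_pos hp1 hp2
    exact pos_of_mul_pos_right h hCpos.le
  have hN₂pos : 0 < N₂.toReal := by
    have h : 0 < C * N₂.toReal := by rw [← h2]; exact mul_pos hp3 hp4
    exact pos_of_mul_pos_right h hCpos.le
  have hN₁0 : N₁ ≠ 0 := (ENNReal.toReal_pos_iff.1 hN₁pos).1.ne'
  have hN₁t : N₁ ≠ ⊤ := (ENNReal.toReal_pos_iff.1 hN₁pos).2.ne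
  have hN₂0 : N₂ ≠ 0 := (ENNReal.toReal_pos_iff.1 hN₂pos).1.ne'
  have hN₂t : N₂ ≠ ⊤ := (ENNReal.toReal_pos_iff.1 hN₂pos).2.ne
  refine ⟨(ENNReal.div_pos hN₂0 hN₁t).ne', ENNReal.div_ne_top hN₂t hN₁0, ?_⟩
  rw [← Real.log_mul hp1.ne' hp2.ne', sub_sub, ← Real.log_mul hp3.ne' hp4.ne', h1, h2,
    Real.log_mul hCpos.ne' hN₁pos.ne', Real.log_mul hCpos.ne' hN₂pos.ne',
    ENNReal.toReal_div, Real.log_div hN₂pos.ne' hN₁pos.ne']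
  ring

end Mollify


end Summit.AtomisticToContinuum.HydrodynamicLimit.Theorems.ParityRigidity
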